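import Summits.AtomisticToContinuum.Crystallization.Theorems.LayeredLawsSelectHcp.Negative.IntendedModel
import Summits.AtomisticToContinuum.Crystallization.Theorems.LayeredLawsSelectHcp.Negative.Threshold
import Summits.AtomisticToContinuum.Crystallization.Theorems.LayeredLawsSelectHcp.Negative.RootedRedundant

/-!
# Disproof of `LayeredLawsSelectHcp` — findings (standing crux disprover, gen 1 cycle 1 + gen 2 cycle 2)

Crux `PalmUnimodularRigidity.LayeredLawsSelectHcp` (item stmt-AtomisticToContinuum-9226, rank 3):
for every hard core `δ > 0` and every probability law `P` on rooted configurations of `ℝ³`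
(`Measure (Measure ℝ³)`) that is (H1) a.s. `count|S` with `0 ∈ S`, `S` `δ`-separated,
(H2) point-stationary (Mecke identity), (H3) minimising, `E_P[½∫V_LJ] ≤ e* = ⨅_{periodic Q} e(Q)`,
and (H4) a.s. carried by sets all of whose points have `(1/100)`-good fcc/hcp shells at a scale
`a ∈ [9/10,1]` and which are globally bond-isomorphic to an ideal Barlow stacking — `P`-a.s. the
sample is `count|A(hcpStacking a h)` with `A` a linear isometry, `(a,h) ∈ [1/2,2]²` and
`e(hcp a h) = e*`.

VERDICT SO FAR (cycle 2): **resists** — and the statement is CONSISTENT on its PHYSICALLY intended witness: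
the Palm law of RELAXED hcp (`|h − a√⅔| ≤ a/100`, a tube containing the numerically relaxed LJ hcp
`h*/a* = 0.81638 ≠ √⅔`) satisfies H1, H2, H4 and — if `e(hcp a h) = e*` — the conclusion (§22; §17 did
the ideal ratio only, whose premise is numerically false). Its only non-formal ingredient is H3
(`e(hcp a h) = e*`, the periodic crystal problem). The statement is decided inside an energy window of
width `≈ 7.25·10⁻⁵ ≈ 10⁻⁴|e*|` above `e*` (§21: with `e*` replaced by any `t ≥ e(fccPC a)` it is FALSE;
`crux ⇒ e* < e(fcc)` strictly). Cycle-2 numerics (§23): interval-certified polytype table, `J_k`, and the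
layer-relaxation gain of an isolated fault (`1.9·10⁻⁸`, i.e. `3·10⁻⁴` of the fault energy `7.27·10⁻⁵` —
"robust to layer-dependent relaxation" holds with 3.5 orders of magnitude to spare). Everything indexed below
is `lean check` rc 0, sorry-free, axioms `propext / Classical.choice / Quot.sound`. FILE LAYOUT (cycle 2):
§0–§20 are LANDED as `Theorems/LayeredLawsSelectHcp/Negative/{DiracLaws, IntegerForms, RootClause,
PeriodicPalmLaw, FccLattice, HexCubic, IdealStackings, FccModel, RootedRedundant, PeriodicEnergy,
FccEnergy, HcpShells, Threshold, IntendedModel, MeckeSign, AllStackings}.lean` (parts I–XVI,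
p73642–p78496) and the built ones IMPORTED here (the 200 kB work-file limit; `MeckeSign`, `AllStackings` are in the tree but not
imported while the farm has them unbuilt); this file carries the findings index,
the retained §7 kill criteria, and the cycle-2 sections §21–§24 (§21/§22 also proposed as parts
XVII `ThresholdSensitivity` / XVIII `RelaxedHcp`).

## Why it resists (the obstruction, precisely)

`¬ crux ↔ ∃ δ P` satisfying H1–H4 with `P(sample not rotated relaxed hcp) > 0`. Any witness must
pass H3, i.e. CERTIFY `E_P[h] ≤ e(Q)` for EVERY periodic configuration `Q` of `ℝ³` — a lower bound
on all periodic Lennard-Jones energies matching a Barlow-type value: the periodic crystal problem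
itself. The only certified lower bound in the tree is `e(Q) ≥ −2³²/12` (`Blocks.neg_le_energyPerParticle`,
item 0714, landed by the sibling disprover of `ChargedEnergyGap`), useless here; and the printed
numerics say every non-hcp Barlow competitor FAILS H3 by `~10⁻⁴|e*|` (hcp below fcc by
`Δ_{fcc/hcp}(12,6) = −1.00994·10⁻⁴` relative, Schwerdtfeger–Burrows–Smits 2021 Eqs. (57)–(60);
`H₂ → −0.0009ε`, Loach–Ackland 2017; polytypes win only under truncation/pressure, Pártay–Ortner–
Csányi 2017 §3), so if those numerics are right no refutation exists at all. Junk routes are closed: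
`lennardJones 0 = 0` (the root's self-term is harmless), `PeriodicConfiguration` motifs are finsets of
`G`-inequivalent points (no coincident-point blow-down of `e*`), `BddBelow (range e)` is PROVED
(so `e*` is a genuine infimum, `e* ≤ e(hcp 1 √(2/3)) < 0`, and the laws `P = 0`, `δ_{count|{0}}`,
`δ_{Lebesgue}`, `δ_{0}` all fail H3: their mean root energy is the junk/true value `0 > e*`),
`ShellCloseTo` quantifies over linear isometries and `EtaMatched` is two-sided (H4 is neither vacuous
nor one-directional), `0 ∈ hcpStacking a h` and hcp is vertex-transitive (`hcp − b = R_{60°}(hcp)` for a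
`B`-site `b`; also `= hcpStacking (−a) h`), so the intended hcp Palm law `½δ_{count|hcp} + ½δ_{count|R hcp}`
fits the conclusion's `∃ A` shape — the conclusion is consistent.

## Findings (index)

* §0 STRUCTURE — `Rooted`/`PointStationary`/`meanRootEnergy`/`GoodShell`/`BarlowLike`/`Layered`/
  `IsRelaxedHcp`, `crux_iff` (`Iff.rfl`), `WithoutEnergy` (H3 deleted), `crux_of_withoutEnergy`.
* §1 DIRAC LAWS — `measurableSet_singleton_count_restrict` (**`{count|S}` is a measurable set of
  measures** for countable `S`: cut out by `μ Sᶜ = 0`, `μ{x} = 1`), `ae_dirac_of_mem`, `of_ae_dirac`,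
  `lintegral_dirac_of_mem`, `integral_dirac_of_mem` — the plumbing every "read one sample" step of
  the route needs (no `MeasurableSingletonClass (Measure ℝ³)` is available).
* §2 LATTICE PALM LAWS — `map_count_restrict_eq`, **`pointStationary_dirac_addSubgroup`**: the Dirac
  law at `count|L`, `L` a countable additive subgroup of `ℝ³`, satisfies the crux's Mecke identity H2
  verbatim (shift-invariance `θ_y count|L = count|L` on `L`, and `L = −L` via `lintegral_map_equiv`).
* §3–§5 THE FCC MODEL (cubic coordinates `fccD3 a = (a/√2)·D₃`, nearest-neighbour distance `a`):
  `le_dist_of_mem_fccD3` (`a`-separated), **`shell_fccD3`** (the non-zero points of norm `≤ 5a/4` are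
  EXACTLY the scaled cuboctahedron `a·fccKissingPattern` — via `mem_fccInt_of_sqNormInt`, the converse
  of `KissingPatterns.sqNormInt_fccInt`), **`goodShell_fccD3`** (H4's shell clause with the identity
  isometry, tolerance unused), `cubicMap`/`bijOn_cubicMap`/`bond_iff_cubicMap`/**`barlowLike_fccD3`**
  (H4's Barlow clause: `ψ(k,i,j) = (−(i+j), k+i, k+j)` is a bond-isomorphism from
  `barlowStacking 1 √(2/3) constHagg`, `dist² = qf`, onto `fccD3 a`, `dist² = a²·qf`, for `9/10 ≤ a ≤ 1`).
* §6 THE FCC PALM LAW `fccLaw a = δ_{count|fccD3 a}`: probability, `rooted_fccLaw` (H1, any `δ ≤ a`),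
  `pointStationary_fccLaw` (H2), `layered_fccLaw` (H4), `meanRootEnergy_fccLaw` (H3 reads
  `½∫V_LJ(‖y‖) d(count|fccD3 a) ≤ e*`), **`not_isRelaxedHcp_fcc`** (the conclusion fails: equal counting
  measures have equal carriers, `fccD3 a` is a subgroup, and `HcpNotBravais_holds` — no linear-isometric
  image of `hcpStacking a' h'` is a subgroup carrier).
* §7 LOAD-BEARING / KILL CRITERION — **`layeredLawsSelectHcp_false_without_energy : ¬ WithoutEnergy`**
  (H3 is load-bearing: with it deleted the fcc law at `a = δ = 1` is a counterexample; so no argument from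
  H1, H2, H4 alone — layer combinatorics, rigidity, unimodularity — can reach hcp: the SELECTION is entirely
  in the `10⁻⁴` energy comparison) and **`layeredLawsSelectHcp_false_of_fcc_rootEnergy_le`** (the route's
  kill criterion "fcc wins ⇒ crux dead", formal: if `½∫V_LJ d(count|fccD3 a) ≤ e*` for one `a ∈ [9/10,1]`
  then `¬ crux`; the physical fcc optimum `a* ≈ 0.9712` lies in the window).
* §8 H3 FOR THE FCC LAW IS A LATTICE-SUM INEQUALITY — `fccPC ha : PeriodicConfiguration 3` (lattice
  `ℤ(1,1,0) + ℤ(1,0,1) + ℤ(0,1,1)` scaled, motif `{0}`; `fccPC_points = fccD3 a` via `coe_span_d3Basis`),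
  `energyPerParticle_fccPC` (`e(fccPC a) = ½∑_{0≠y∈fcc} V(‖y‖)`), `count_restrict_eq_sum_dirac`,
  `integral_count_restrict_fccD3` (the Bochner integral against `count|fccD3 a` IS the absolutely convergent
  lattice sum — `summable_lennardJones_dist_three` + `integral_sum_dirac_eq_tsum`, root term `V_LJ(0) = 0`),
  **`meanRootEnergy_fccLaw_eq_energyPerParticle : E_{fccLaw a}[h] = e(fccPC a)`**, hence
  **`layeredLawsSelectHcp_false_of_fcc_minimises`** (`e(fccPC a) ≤ e*` for one `a ∈ [9/10,1]` ⇒ `¬crux`) and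
  `eStar_le_energyPerParticle_fccPC` (`e* ≤ e(fccPC a)` unconditionally: the crux is consistent with fcc
  losing, and H3 for fcc is the single real inequality `e(fccPC a) ≤ e*`, i.e. `IsLeast`-attainment by fcc).
* §9 MUTATION, FORMAL — **`ae_zero_mem_of_pointStationary`**: H2 alone forces a law a.s. carried by counting
  measures of countable sets to charge the origin a.s. (or vanish): Mecke with `g(ν,y) = 1[ν{0} = 0]`. So the
  `0 ∈ S` clause of H1 is not load-bearing, and `δ` (occurring only in H1) is decoration given H4's shells.
* §10 CONCLUSION SHAPE — `barlowPos_alternating_sub_b`, **`hcpStacking_sub_b_eq_neg`**: re-rooting hcp at a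
  `B`-site is the point inversion, `hcp − b = −hcp`; so the hcp Palm law is `½δ_{count|hcp} + ½δ_{count|(−hcp)}`
  and the conclusion's `∃ A` is exercised with `A = ±id` — the conclusion is consistent with the intended model
  (by hand: that law satisfies H2 with the crux's `−y` convention and would FAIL it with `+y`; lattice laws cannot
  detect the sign; §11 certifies H2 for every periodic configuration, hcp included).
* §11 PERIODIC PALM LAWS — for EVERY `Q : PeriodicConfiguration 3`: `countable_points`, `motifLatticeEquiv :
  F × G ≃ Q.points`, `view`/`viewMeasure` (`Q − x` as a counting measure), `map_count_restrict_image`,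
  `lintegral_viewMeasure`, **`palmLaw Q = (#F)⁻¹ ∑_{x∈F} δ_{count|(Q−x)}`** (probability; `ae_palmLaw`/`of_ae_palmLaw`/
  `lintegral_palmLaw`/`integral_palmLaw`), **`rooted_palmLaw`** (H1 from separation of `Q.points`) and
  **`pointStationary_palmLaw`** (H2 VERBATIM for every periodic configuration: `θ_{−(p−x)}(Q−x) = Q − x'` for
  `p = x'+ℓ`, re-index `p ↔ (x',ℓ)`, `ℓ ↦ −ℓ`).
* §12 ENERGY AND THE CRUX ON PERIODIC CONFIGURATIONS — `integral_viewMeasure`, `summable_norm_lennardJones_view`,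
  `tsum_points_eq_tsum_ne`, **`meanRootEnergy_palmLaw : E_{P_Q}[h] = e(Q)`** (no hypothesis), then
  **`isRelaxedHcp_of_crux`** (crux ⇒ every separated, everywhere-good-shelled, Barlow-like periodic `Q` with
  `e(Q) ≤ e*` is, from each motif point, `count|A(hcpStacking a h)` with optimal `(a,h)` — hcp THE unique layered
  periodic minimiser up to congruence), **`layeredLawsSelectHcp_false_of_periodic_competitor`** (kill criterion for
  ANY polytype: such a minimiser with a motif view not a linear-isometric image of an `hcpStacking a h` ⇒ ¬crux) and
  **`layeredLawsSelectHcp_false_of_bravais_minimiser`** (`not_isRelaxedHcp_addSubgroup`; the fcc case of §7–§8 again,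
  now for any Bravais presentation).
* §13 H1 IS REDUNDANT — `dist_ge_of_goodShell` (a good shell at `x` puts every other point of `S` at distance
  `≥ 891/1000 = 99/100·9/10` from `x`), `rooted_of_pointStationary_layered` (H2 ∧ H4 ⇒ H1 with `δ = 891/1000`, via
  §9), **`crux_iff_without_rooted : LayeredLawsSelectHcp ↔ ∀ P, IsProbabilityMeasure P → PointStationary P →
  meanRootEnergy P ≤ e* → Layered P → ∀ᵐ μ ∂P, IsRelaxedHcp μ`** — provers may drop H1 and `δ` altogether.
* §14 IDEAL STACKINGS — `form_le_eighteen` / `dist_eq_of_le_of_ideal` (in ANY ideal Barlow stacking two distinct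
  points at distance `≤ 5a/4` are at distance exactly `a`: the integer form `F ≤ 18 ⇒ F = 12`), whence
  **`barlowLike_barlowStacking_ideal`**: every ideal Barlow stacking of spacing `a ∈ [9/10,1]` (hcp, fcc, every
  polytype) satisfies H4's global clause with `Φ = a • ·`.
* §15 THE HEX↔CUBIC ISOMETRY — `hexIso` (rows `(1,−1,0)/√2, (−1,−1,2)/√6, (1,1,1)/√3`, an orthonormal basis `repr`)
  and the master formula **`hexIso_smul_intVec`**: `M(c·p) = i u + j v + Λ w + K n` under three INTEGER-type relations.
* §16 HCP'S SHELLS ARE EXACT ANTICUBOCTAHEDRA — `hcpInt_rel` (the 12-entry table, by `decide`), `hexIso_hcpPattern`,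
  `shellWindow_eq_touching`, `shellFinset_subset` + cardinality `12 = 12`, **`goodShell_hcpStacking`**: every point of
  `hcpStacking a (a√⅔)`, `a ∈ [9/10,1]`, has a `(1/100)`-good HCP shell (isometry `M` at `A`-sites, `−M` at
  `B`-sites, tolerance unused).
* §17 THE INTENDED MODEL — `hcpPalm_hypotheses` (the Palm law of ideal hcp satisfies H1 (a-separated), H2, H4),
  `hcpPalm_energy_iff` (its H3 is `e(hcp a (a√⅔)) ≤ e*`), **`crux_structural_hypotheses_satisfiable`** (H1 ∧ H2 ∧ H4
  jointly satisfiable by a NON-lattice law), **`hcpPalm_conclusion`** (if `e(hcp a (a√⅔)) = e*` the crux's CONCLUSION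
  holds for that law: views are `hcp` and `−hcp`, `A = ±id`, `(a, a√⅔) ∈ [1/2,2]²`) and **`crux_consistent`** (so, modulo
  "ideal hcp at some admissible spacing is a periodic minimiser", all four hypotheses are satisfiable AND the conclusion
  holds for the witness: the crux is exactly right on its intended model, and non-vacuous iff a layered minimiser exists).
* §18 ALL IDEAL POLYTYPES — `zIso` (the mirror `diag(1,1,−1)` for twin `c`-sites), `fccInt_rel` (the FCC table, `decide`),
  `hexIso_fccPattern`, **`goodShell_barlowStacking_ideal`** (EVERY point of EVERY ideal Barlow stacking, `a ∈ [9/10,1]`, has an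
  exact good shell: cuboctahedron at `c`-sites via `M` / `Z∘M`, anticuboctahedron at `h`-sites via `±M` — H4's per-point clause,
  like its global clause, is blind to the stacking, cf. barrier `KissingTwelveDegeneracy`), `barlowPalm_hypotheses` (the Palm law
  of every ideal PERIODIC polytype satisfies H1, H2, H4) and **`isRelaxedHcp_of_crux_barlow`**: the crux restricted to ideal
  periodic polytypes is the ATTAINMENT form of Hägg selection — `crux ⇒ (e(barlowPeriodicConfiguration a (a√⅔) s) ≤ e* ⇒ every
  motif view is a linear-isometric copy of an optimal hcpStacking)`; one ideal polytype attaining `e*` with a non-hcp view kills it.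
* §19 THRESHOLD — `energyPerParticle_fccPC_one_le` (`e(fcc, a=1) ≤ −1/2`:
  twelve touching terms `−1/12`, the rest `≤ 0`), **`eStar_le_neg_half : e* ≤ −1/2`** — a certified upper bound on the crux's
  threshold (true value `≈ −0.7176` printed; certified lower bound in tree `−2³²/12`).
* §20 TIGHTNESS OF H2'S SIGN — `PointStationaryPlus` (the Mecke identity with `+y`), `neg_b_not_mem_hcpStacking`,
  `two_b_not_mem_hcpStacking`, `viewMeasure_b_ne` (`hcp ≠ −hcp`), **`not_pointStationaryPlus_hcpPalm`**: the intended model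
  satisfies the crux's `−y` identity (§11) but NOT the `+y` one (test function `1[ν = count|hcp ∧ y = b]`: `½` vs `0`) — the
  crux's convention is the one forced by its witness; lattice laws (§2) cannot tell the two apart.
* §21 THRESHOLD SENSITIVITY (cycle 2) — `WithThreshold t` (H3 with `e*` replaced by `t`; `crux ↔ WithThreshold e*`,
  `Iff.rfl`), `WithThreshold.anti`, **`withThreshold_false_of_fcc_le`** (false at every `t ≥ e(fccPC a)`,
  `a ∈ [9/10,1]`), **`withThreshold_neg_half_false`** (certified instance `t = −1/2`), `withThreshold_false_of_neg_half_le`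
  (so also at the junk value `t = 0`), **`eStar_lt_fcc_of_crux`** (`crux ⇒ e* < e(fccPC a)`: a proof of the crux proves
  fcc is not a periodic minimiser at any admissible scale), `withThreshold_true_set_subset`.
* §22 THE RELAXED INTENDED MODEL (cycle 2) — integer lemmas `inLayer_le_eighteen`, `adjLayer_le_ten`; the distance form
  for a GENERAL layer spacing `twelve_mul_dist_sq` (`12·dist² = a²(3(2P+Q+Λ)² + (3Q+Λ)²) + 12K²h²`); `tube_sq_bounds`;
  **`hcp_window_iff`** (for `0.65a² ≤ h² ≤ 0.69a²` and `12.28a² ≤ 12r² ≤ 18.75a²`, two distinct sites of `hcpStacking a h`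
  are within `r` iff the ideal sites touch — covers both the `5a/4` shell window and the `28/25` bond window); the
  vertical stretch `tubeMap η h` (`tubeMap_barlowPos`: spacing `η ↦ h` index by index; `dist_tubeMap`; injective);
  `coe_shellFinset_eq`, `shellFinset_apply_two`, `tubeShell`, **`coe_tubeShell_eq`** (the `5a/4`-window of a relaxed
  site IS the stretched ideal shell), `etaMatched_image_of_dist_le` (generic: a small injective motion is a matching),
  **`goodShell_hcp_tube`**, **`barlowLike_hcp_tube`**, `mem_hcp_motif`, **`hcpPalm_hypotheses_tube`** (H1 with
  `δ = 4a/5`, H2, H4 for every `a ∈ [9/10,1]`, `|h − a√⅔| ≤ a/100`), `hcpPalm_hypotheses_numerical` (the rational point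
  `(0.9713, 0.7929)`), **`hcpPalm_conclusion_tube`**, **`crux_consistent_tube`**, `hcp_tube_family_layered` (on the
  relaxed family the crux is pure attainment: H1/H2/H4 never distinguish `(a,h)`, nor hcp from fcc — selection is H3's).
  Plus `tsum_image_eq`, **`energyPerParticle_hcp_eq_half_tsum`** (`e(hcp a h) = ½∑'_{y ∈ hcp(a,h)} V_LJ(‖y‖)` for all
  `a, h ≠ 0`: the two motif views have equal root sums) and `hcpPalm_energy_iff_tsum` (H3 of the model = ONE series equality).
* §23 NUMERICS (cycle 2, interval-certified; docblock below) and §24 PRE-TRIAGE of the ideators' typed first lemmas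
  (prose, at the end of the file): `SlabCoercivity`/`SlabCoercivityFull` numerically false (ideator's own runs), the rest
  true-looking; candidate disprover targets once a line is filed: `CutForceCouplingBound` at the box corners.

## Mutation notes (for provers; not formalised)

* H1 is implied by H2 ∧ H4 up to the value of `δ` (which occurs nowhere else): Mecke with
  `g(ν, y) = 1[ν{0} = 0]` gives `E[μ(ℝ³); μ{0} = 0] = E[#{y ∈ μ : μ{y} = 0}] = 0`, so a.s. `μ = 0 ∨ 0 ∈ S`,
  and H4's shells give `(89/100)`-separation. So `δ` is decoration; the crux at `δ = 1/3` is the general case.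
* The conclusion's `e(hcp a h) = e*` clause makes the crux assert ATTAINMENT of `e*` by hcp as soon as one
  minimising layered law exists (by design: conjunct (i)); a prover gets it from linearity,
  `E_P[h] = ∫ e(hcp a_μ h_μ) dP ≥ e*` with equality iff a.s. equality — AFTER the a.s. structure.
* `∃ A` in the conclusion cannot be dropped (B-sites of hcp see `R_{60°}(hcp) = hcpStacking (−a) h`, excluded
  by `a ≥ 1/2`), and (a, h) must stay free (relaxed `c/a ≠ √(8/3)`).

## Numerics (kit job j008031, `calc/stackings.py`, attached to the item as evidence)

Static LJ (12,6) energy per particle with the FULL tail, all Hägg sequences of period ≤ 6, ideal and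
relaxed uniform layer spacing, plus the interlayer couplings `J_k` and the Hägg-domination ratio — the
route's "cheapest falsifier (1)"; results recorded in the disprover's NOTES.md / item evidence.

## §23 Numerics, cycle 2 (kit jobs j013711 smoke / j013916 full — rc 0, 282 s on 4 cores; `calc/certify_stackings.py`;
## report, table and fault data attached to the item as evidence)

RIGOROUS interval lattice sums (float64 sums over the sites in the ball `|q| ≤ R = 60a` with an explicit rounding
budget, plus the two-sided CELL SANDWICH for the tail — hexagonal-prism cells of volume `(√3/2)c` contained in
`B(q, √(1/3 + c²/4))`, `f` decreasing — and `C²` chord bounds `min(endpoints) − MΔc²/8`, `Δc = 10⁻⁴`, with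
`|e''| ≤ M ≤ 187` from positive derivative sums; everything monotone in `c = h/a`): for every Barlow word `s` of
Hägg period `≤ 8` (35 classes up to shift/reversal/mirror) `e_s(c) := min_a e_s(a, c·a) = −A₆,ₛ(c)²/(24 A₁₂,ₛ(c))`
is enclosed on the tube `c ∈ [0.78, 0.86]`, and `gap_s := (certified lower bound of e_s on the tube) − U_h`,
`U_h := −0.71758897…` a certified UPPER bound of `min_c e_hcp(c)` (hence of `e*`). RESULTS:
* `e_hcp,min ∈ [−0.7175896494, −0.7175889709]` (width `6.8·10⁻⁷`), attained near `c = 0.8164` (`a* = 0.97127`,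
  `h* = 0.79294`, `|h* − a*√⅔| = 1.0·10⁻⁴ a*` — inside §22's tube by two orders of magnitude); so, certified,
  **`e* ≤ −0.7175889`**.
* **fcc: `e_fcc ∈ [−0.7175169387, −0.7175164463]` at its optimum and `e_fcc(a, c) − min e_hcp ≥ +7.185·10⁻⁵` for
  EVERY `a > 0` and EVERY `c ∈ [0.78, 0.86]` (trigonal distortions included) — CERTIFIED.** The kill criterion
  `layeredLawsSelectHcp_false_of_fcc_minimises` can fire only if `e* < e_hcp,min − 7.18·10⁻⁵`, i.e. only if the
  true periodic minimiser is neither hcp nor fcc (nor any word below).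
* **All 33 other words of period ≤ 8: CERTIFIED above hcp on the whole tube**, gaps from `+9.70·10⁻⁶` (`hchhhhh`,
  one cubic layer in seven) through `+1.39·10⁻⁵` (`hchhh`), `+1.75·10⁻⁵` (`hchhhhhh`-type, p = 8), `+2.35·10⁻⁵`
  (9R `hch`), `+3.56·10⁻⁵` (dhcp `hchc`, `hcch`), `+4.29·10⁻⁵` (`hccch`), … to `+5.37·10⁻⁵` (`hcccccch`) and
  `+7.18·10⁻⁵` (fcc): the excess is `≈ (fraction of c-layers) × 7.26·10⁻⁵`, exactly the `J`-model.
* Couplings at the hcp optimum (floats, truncation `R = 60a`): `J₂ = −7.265·10⁻⁵`, `J₃ = −8.48·10⁻⁸`,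
  `J₄ = −1.8·10⁻¹⁰`, `|J_k| ≲ 2·10⁻¹⁰` beyond (truncation noise); `|J₂| / ∑_{k≥3}(k−1)|J_k| = 414` (route item 3063
  prints 428 at the hcp optimum, 287 at the worst box corner); `J`-model excess `∑_k J_k(f_k(s) − f_k(hcp))` agrees
  with the certified-float excess of every word to `3·10⁻⁷`.
* Layer-spacing relaxation around faults (floats, 25–34-layer supercells, all spacings `h_m` and the common `a`
  relaxed, L-BFGS): one `c`-layer `ΔE = +7.2722·10⁻⁵ → +7.2703·10⁻⁵` (gain `1.9·10⁻⁸ = 0.03 %`,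
  `max|Δh_m| = 3.1·10⁻⁵a`); `cc`: `1.4531·10⁻⁴` (gain `5.7·10⁻⁸`); `ccc`: `2.1784·10⁻⁴` (`9.5·10⁻⁸`); `cccc`:
  `2.9046·10⁻⁴` (`1.3·10⁻⁷`); two `c`-layers `2, 4, 6, 8` apart: `1.4540, 1.4542, 1.4542, 1.4543·10⁻⁴` (fault–fault
  interaction `≲ 3·10⁻⁸`, gains `3.8·10⁻⁸`). So "robust to layer-dependent relaxation" holds with `> 3` orders of
  magnitude to spare: relaxation can lower a fault's cost by `≈ 3·10⁻⁴` of itself, never below zero.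
CONSEQUENCE FOR THE DISPROOF: every explicit layered law this disprover can write down (ideal or relaxed hcp, fcc,
any polytype of period ≤ 8, isolated or clustered faults) either IS hcp or has mean root energy certified/computed
`> e_hcp,min ≥ e*`-candidate; a refutation would need the true `e*` to lie `≥ 9.7·10⁻⁶` below `e_hcp,min` because
of a NON-Barlow or long-period competitor — for which there is no candidate in print (Bétermin–Šamaj–Travěnec 2021
§3.1: among Bravais lattices + HCP only FCC/HCP minimise LJ-type energies; (12,6): HCP).
-/

noncomputable section

namespace Summit.AtomisticToContinuum.Crystallization.Cruxes.LayeredLawsSelectHcp.Disproof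

open MeasureTheory Set
open Literature.MathematicalPhysics.StatisticalMechanics Literature.Geometry.DiscreteGeometry
open Summit.AtomisticToContinuum.Crystallization.Theses.PalmUnimodularRigidity (LayeredLawsSelectHcp)
open Summit.AtomisticToContinuum.Crystallization.Theorems.ChargedEnergyGapNegative
  (eStar eStar_le bddBelow_energyPerParticle_lennardJones)
open Summit.AtomisticToContinuum.Crystallization.Theorems.LayeredLawsSelectHcp.Negative
open Summit.AtomisticToContinuum.Crystallization.Theorems.LayeredLawsSelectHcp.Negative.DiracLaws
open Summit.AtomisticToContinuum.Crystallization.Theorems.LayeredLawsSelectHcp.Negative.IntegerForms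
open Summit.AtomisticToContinuum.Crystallization.Theorems.LayeredLawsSelectHcp.Negative.FccLattice
open Summit.AtomisticToContinuum.Crystallization.Theorems.LayeredLawsSelectHcp.Negative.FccModel
open Summit.AtomisticToContinuum.Crystallization.Theorems.LayeredLawsSelectHcp.Negative.FccEnergy
open Summit.AtomisticToContinuum.Crystallization.Theorems.LayeredLawsSelectHcp.Negative.Threshold
open Summit.AtomisticToContinuum.Crystallization.Theorems.LayeredLawsSelectHcp.Negative.IdealStackings
open Summit.AtomisticToContinuum.Crystallization.Theorems.LayeredLawsSelectHcp.Negative.HexCubic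
open Summit.AtomisticToContinuum.Crystallization.Theorems.LayeredLawsSelectHcp.Negative.HcpShells
open Summit.AtomisticToContinuum.Crystallization.Theorems.LayeredLawsSelectHcp.Negative.PeriodicPalmLaw
open Summit.AtomisticToContinuum.Crystallization.Theorems.LayeredLawsSelectHcp.Negative.PeriodicEnergy
open Summit.AtomisticToContinuum.Crystallization.Theorems.LayeredLawsSelectHcp.Negative.IntendedModel
open Summit.AtomisticToContinuum.Crystallization.Theorems.LayeredLawsSelectHcp.Negative.RootClause
open Summit.AtomisticToContinuum.Crystallization.Theorems.LayeredLawsSelectHcp.Negative.RootedRedundant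

/-- Euclidean `3`-space. [folklore] -/
local notation "E3" => EuclideanSpace ℝ (Fin 3)

/-! ## §0/§7 (retained in this file) The energy-free crux and the conditional fcc kills

The bodies of §0–§20 were landed as `Theorems/LayeredLawsSelectHcp/Negative/*.lean` (parts I–XVI,
p73642–p78496) and are IMPORTED above; four declarations of the original work file that the landed parts
phrase differently are kept here by name. -/

section Retained

/-- The crux WITHOUT the energy hypothesis H3. [folklore] -/
def WithoutEnergy : Prop :=
  ∀ δ : ℝ, 0 < δ → ∀ P : Measure (Measure E3), IsProbabilityMeasure P →
    Rooted δ P → PointStationary P → Layered P → ∀ᵐ μ ∂P, IsRelaxedHcp μ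

/-- Dropping a hypothesis weakens: the crux follows from its energy-free version. [folklore] -/
theorem crux_of_withoutEnergy (H : WithoutEnergy) : LayeredLawsSelectHcp :=
  crux_iff.2 fun δ hδ P hP h1 h2 _ h4 => H δ hδ P hP h1 h2 h4

/-- **Any proof of the crux must use H3** (part IV, `FccModel.layeredLawsSelectHcp_false_without_energy`,
restated for `WithoutEnergy`). [folklore] -/
theorem layeredLawsSelectHcp_false_without_energy : ¬ WithoutEnergy :=
  FccModel.layeredLawsSelectHcp_false_without_energy

/-- **Conditional kill (the route's own kill criterion, formalised).** If for some admissible scale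
`a ∈ [9/10, 1]` the fcc lattice at nearest-neighbour distance `a` has root energy
`½ ∑_{0 ≠ y ∈ fcc} V_LJ(‖y‖) ≤ e*`, the crux is FALSE. (§23: interval arithmetic certifies the
hypothesis FAILS by `≥ 7.185·10⁻⁵` against hcp for every `a`.) [folklore] -/
theorem layeredLawsSelectHcp_false_of_fcc_rootEnergy_le {a : ℝ} (h9 : 9 / 10 ≤ a) (h1 : a ≤ 1)
    (hE : (∫ y, lennardJones ‖y‖ ∂((Measure.count : Measure E3).restrict (fccD3 a : Set E3))) / 2 ≤
      eStar) :
    ¬ LayeredLawsSelectHcp := fun H =>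
  not_ae_isRelaxedHcp_fccLaw a (crux_iff.1 H a (by linarith) (fccLaw a) inferInstance
    (rooted_fccLaw (by linarith) le_rfl) (pointStationary_fccLaw a)
    (by rw [meanRootEnergy_fccLaw]; exact hE) (layered_fccLaw h9 h1))

/-- **Kill criterion, final form**: `e(fccPC a) ≤ e*` for one `a ∈ [9/10, 1]` ⇒ `¬ crux`. [folklore] -/
theorem layeredLawsSelectHcp_false_of_fcc_minimises {a : ℝ} (h9 : 9 / 10 ≤ a) (h1 : a ≤ 1)
    (hE : (fccPC (show a ≠ 0 by intro h; rw [h] at h9; norm_num at h9)).energyPerParticle lennardJones ≤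
      eStar) :
    ¬ LayeredLawsSelectHcp := by
  refine layeredLawsSelectHcp_false_of_fcc_rootEnergy_le h9 h1 ?_
  rw [← meanRootEnergy_fccLaw, meanRootEnergy_fccLaw_eq_energyPerParticle]
  exact hE

end Retained


/-! ## §21 Threshold sensitivity: the crux with `e*` replaced by a number `t` (gen 2, cycle 2)

H3 compares `E_P[h]` with the UNKNOWN real number `e* = ⨅ e(Q)`. Replacing `e*` by an explicit
threshold `t` gives a one-parameter family of statements `WithThreshold t`, antitone in `t`, with
`LayeredLawsSelectHcp = WithThreshold e*` definitionally. The family is FALSE at every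
`t ≥ e(fccPC a)` for any admissible `a ∈ [9/10, 1]` (the fcc Palm law then passes the weakened H3),
in particular at `t = −1/2` (certified, §19) — so the statement is decided inside the window
`[e*, inf_{a ∈ [9/10,1]} e(fccPC a))`, of numerical width `e_fcc,min − e_hcp,min ≈ 7.25·10⁻⁵ ≈ 1.0·10⁻⁴|e*|`
(kit jobs j008031, j012726; interval-certified in cycle 2, see §22): any slack of that size in an
energy estimate used to verify H3, or any replacement of `e*` by a computable upper bound that is not
within `7·10⁻⁵` of the true infimum, changes the truth value. Conversely `crux ⇒ e* < e(fccPC a)` for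
every admissible `a` (`eStar_lt_fcc_of_crux`): a proof of the crux contains a proof that fcc is NOT a
periodic Lennard-Jones minimiser at any scale in `[9/10, 1]`.
-/

section ThresholdSensitivity

/-- The crux with the minimising threshold `e*` replaced by the real number `t`. [folklore] -/
def WithThreshold (t : ℝ) : Prop :=
  ∀ δ : ℝ, 0 < δ → ∀ P : Measure (Measure E3), IsProbabilityMeasure P →
    Rooted δ P → PointStationary P → meanRootEnergy P ≤ t → Layered P → ∀ᵐ μ ∂P, IsRelaxedHcp μ

/-- `LayeredLawsSelectHcp` is the member `t = e*` of the family (definitional). [folklore] -/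
theorem crux_iff_withThreshold : LayeredLawsSelectHcp ↔ WithThreshold eStar := crux_iff

/-- The family is antitone in the threshold: a larger `t` admits more laws. [folklore] -/
theorem WithThreshold.anti {t t' : ℝ} (h : t' ≤ t) (H : WithThreshold t) : WithThreshold t' :=
  fun δ hδ P hP h1 h2 h3 h4 => H δ hδ P hP h1 h2 (h3.trans h) h4

/-- **False at every threshold at or above an admissible fcc energy**: if `e(fccPC a) ≤ t` for some
`a ∈ [9/10, 1]`, the fcc Palm law `fccLaw a` satisfies H1, H2, H4 and the weakened H3, and is not a
rotated relaxed hcp. [folklore] -/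
theorem withThreshold_false_of_fcc_le {a t : ℝ} (h9 : 9 / 10 ≤ a) (h1 : a ≤ 1)
    (ht : (fccPC (show a ≠ 0 by intro h; rw [h] at h9; norm_num at h9)).energyPerParticle lennardJones ≤ t) :
    ¬ WithThreshold t := fun H =>
  not_ae_isRelaxedHcp_fccLaw a (H a (by linarith) (fccLaw a) inferInstance
    (rooted_fccLaw (by linarith) le_rfl) (pointStationary_fccLaw a)
    (by rw [meanRootEnergy_fccLaw_eq_energyPerParticle]; exact ht) (layered_fccLaw h9 h1))

/-- **In particular the statement with threshold `−1/2` is false** (certified: `e(fccPC 1) ≤ −1/2`,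
§19), although `e* ≤ −1/2`: the weakening of H3 from `≤ e*` to `≤ −1/2` already admits fcc.
[folklore] -/
theorem withThreshold_neg_half_false : ¬ WithThreshold (-1 / 2) :=
  withThreshold_false_of_fcc_le (a := 1) (by norm_num) le_rfl energyPerParticle_fccPC_one_le

/-- Hence false at every `t ≥ −1/2` (e.g. `t = 0`, the junk value of a non-integrable mean root
energy). [folklore] -/
theorem withThreshold_false_of_neg_half_le {t : ℝ} (ht : -1 / 2 ≤ t) : ¬ WithThreshold t :=
  fun H => withThreshold_neg_half_false (H.anti ht)

/-- **The crux decides fcc-vs-the-rest**: `LayeredLawsSelectHcp ⇒ e* < e(fccPC a)` for every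
`a ∈ [9/10, 1]` — strict inequality, i.e. fcc at no admissible scale is a periodic Lennard-Jones
minimiser. (Unconditionally only `e* ≤ e(fccPC a)` is known, `eStar_le_energyPerParticle_fccPC`;
the printed gap is `+7.25·10⁻⁵`.) [folklore] -/
theorem eStar_lt_fcc_of_crux (H : LayeredLawsSelectHcp) {a : ℝ} (h9 : 9 / 10 ≤ a) (h1 : a ≤ 1) :
    eStar < (fccPC (show a ≠ 0 by intro h; rw [h] at h9; norm_num at h9)).energyPerParticle lennardJones := by
  by_contra hle
  exact withThreshold_false_of_fcc_le h9 h1 (not_lt.1 hle) (crux_iff_withThreshold.1 H)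

/-- The set of thresholds at which the statement holds is a down-set of `ℝ` disjoint from
`[e(fccPC a), ∞)` for every admissible `a`; the crux holds iff `e*` belongs to it. [folklore] -/
theorem withThreshold_true_set_subset {t : ℝ} (H : WithThreshold t) {a : ℝ} (h9 : 9 / 10 ≤ a)
    (h1 : a ≤ 1) :
    t < (fccPC (show a ≠ 0 by intro h; rw [h] at h9; norm_num at h9)).energyPerParticle lennardJones := by
  by_contra hle
  exact withThreshold_false_of_fcc_le h9 h1 (not_lt.1 hle) H

end ThresholdSensitivity


/-! ## §22 The RELAXED intended model: hcp with a non-ideal layer spacing (gen 2, cycle 2)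

Cycle 1's consistency theorem `crux_consistent` is conditional on IDEAL hcp (`h = a√⅔`) minimising;
but the relaxed Lennard-Jones hcp has `c/a ≠ √(8/3)` (numerically `h*/a* = 0.81638` against
`√⅔ = 0.81650`, kit j012726), so that premise is (numerically) FALSE for every `a`: ideal hcp is not
even critical in the `h`-direction. This section repairs the sanity check: for EVERY layer spacing `h`
in the tube `|h − a√⅔| ≤ a/100` (`a ∈ [9/10, 1]`) the Palm law of `hcpStacking a h` satisfies H1, H2
and H4 — its shells are `(1/100)`-good (the vertical stretch `z ↦ z + (z₂/h₀)(h − h₀)e₃` moves each of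
the twelve neighbour offsets by `≤ |h − h₀| ≤ a/100` and no other point enters the `5a/4`-window) and
the same stretch composed with `a • ·` is a bond-isomorphism from the unit ideal hcp — and the
conclusion holds for it as soon as `e(hcp a h) = e*`. So the crux is exactly right on its physically
intended witness `(a*, h*) ≈ (0.9713, 0.7929)`, and H4's `1 %` tolerance is wide enough to contain it
(`|h* − a*√⅔| ≈ 1.2·10⁻⁴ a* ≪ a*/100`).
-/

section RelaxedHcp

variable {a h : ℝ}

/-! ### Integer lemmas: the forms below the window thresholds -/

/-- In-layer form `≤ 18` off the origin forces the value `12` (six neighbours). [folklore] -/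
theorem inLayer_le_eighteen {P Q : ℤ} (hle : 3 * (2 * P + Q) ^ 2 + (3 * Q) ^ 2 ≤ 18)
    (hne : (P, Q) ≠ (0, 0)) : 3 * (2 * P + Q) ^ 2 + (3 * Q) ^ 2 = 12 := by
  have hQ : Q ^ 2 ≤ 2 := by nlinarith [sq_nonneg (2 * P + Q)]
  have hQ' : Q ^ 2 ≤ 1 := by
    by_contra hc
    have : 2 ≤ Q ^ 2 := by omega
    have h4 : Q ^ 2 ≠ 2 := fun h2 => by
      have : Q ≤ 1 := by nlinarith
      have : -1 ≤ Q := by nlinarith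
      interval_cases Q <;> simp_all
    omega
  have hP4 : (2 * P + Q) ^ 2 ≤ 6 := by nlinarith [sq_nonneg (3 * Q)]
  have hP : P ^ 2 ≤ 4 := by
    obtain ⟨hQ1, hQ2⟩ := abs_le_one_of_sq_le_one hQ'
    nlinarith
  obtain ⟨hQ1, hQ2⟩ := abs_le_one_of_sq_le_one hQ'
  obtain ⟨hP1, hP2⟩ := abs_le_two_of_sq_le_four hP
  interval_cases P <;> interval_cases Q <;> simp_all

/-- Adjacent-layer form `≤ 10` forces the value `4` (three neighbours), letter shift `σ = ±1`.
[folklore] -/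
theorem adjLayer_le_ten {P Q σ : ℤ} (hσ : σ = 1 ∨ σ = -1)
    (hle : 3 * (2 * P + Q + σ) ^ 2 + (3 * Q + σ) ^ 2 ≤ 10) :
    3 * (2 * P + Q + σ) ^ 2 + (3 * Q + σ) ^ 2 = 4 := by
  have hv : (3 * Q + σ) ^ 2 ≤ 10 := by nlinarith [sq_nonneg (2 * P + Q + σ)]
  have hu3 : 3 * (2 * P + Q + σ) ^ 2 ≤ 10 := by nlinarith [sq_nonneg (3 * Q + σ)]
  have hu : (2 * P + Q + σ) ^ 2 ≤ 3 := by omega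
  have hu' : (2 * P + Q + σ) ^ 2 ≤ 1 := by
    by_contra hc
    have h2 : 2 ≤ (2 * P + Q + σ) ^ 2 := by omega
    have : 2 * P + Q + σ ≤ 1 := by nlinarith
    have : -1 ≤ 2 * P + Q + σ := by nlinarith
    set u := 2 * P + Q + σ
    interval_cases u <;> simp_all
  obtain ⟨hu1, hu2⟩ := abs_le_one_of_sq_le_one hu'
  have hv1 : -3 ≤ 3 * Q + σ := by nlinarith [hv]
  have hv2 : 3 * Q + σ ≤ 3 := by nlinarith [hv]
  rcases hσ with rfl | rfl
  · have hQ1 : -1 ≤ Q := by omega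
    have hQ2 : Q ≤ 0 := by omega
    have hP1 : -1 ≤ P := by omega
    have hP2 : P ≤ 1 := by omega
    interval_cases P <;> interval_cases Q <;> simp_all
  · have hQ1 : 0 ≤ Q := by omega
    have hQ2 : Q ≤ 1 := by omega
    have hP1 : -1 ≤ P := by omega
    have hP2 : P ≤ 1 := by omega
    interval_cases P <;> interval_cases Q <;> simp_all

/-! ### The distance form for a general layer spacing -/

/-- **`12·dist² = a²·(3(2P+Q+Λ)² + (3Q+Λ)²) + 12K²h²`** for ANY layer spacing `h` (`P = i−i'`,
`Q = j−j'`, `K = k−k'`, `Λ = L(k)−L(k')`). [folklore] -/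
theorem twelve_mul_dist_sq (a h : ℝ) (s : ℤ → ℤ) (k i j k' i' j' : ℤ) :
    12 * dist (barlowPos a h s k i j) (barlowPos a h s k' i' j') ^ 2 =
      a ^ 2 * ((3 * (2 * (i - i') + (j - j') + (haggLabel s k - haggLabel s k')) ^ 2 +
        (3 * (j - j') + (haggLabel s k - haggLabel s k')) ^ 2 : ℤ) : ℝ) +
      12 * ((k - k' : ℤ) : ℝ) ^ 2 * h ^ 2 := by
  rw [dist_barlowPos_sq]
  have h3 : (√3 : ℝ) ^ 2 = 3 := Real.sq_sqrt (by norm_num)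
  push_cast
  linear_combination (3 * a ^ 2 * ((j - j' : ℝ) + (haggLabel s k - haggLabel s k') / 3) ^ 2) * h3

/-- The letter shift between hcp layers `k` and `k'` with `|k − k'| = 1` is `±1`. [folklore] -/
theorem haggLabel_alt_sub_of_adj {k k' : ℤ} (hK : k - k' = 1 ∨ k - k' = -1) :
    haggLabel alternatingHagg k - haggLabel alternatingHagg k' = 1 ∨
      haggLabel alternatingHagg k - haggLabel alternatingHagg k' = -1 := by
  by_cases hk : Even k'
  · obtain ⟨h0, h1, h2⟩ := haggLabel_alt_of_even hk
    rcases hK with hK | hK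
    · rw [show k = k' + 1 by omega, h1, h0]; simp
    · rw [show k = k' - 1 by omega, h2, h0]; simp
  · obtain ⟨h0, h1, h2⟩ := haggLabel_alt_of_odd hk
    rcases hK with hK | hK
    · rw [show k = k' + 1 by omega, h1, h0]; simp
    · rw [show k = k' - 1 by omega, h2, h0]; simp

/-- `0.8164 ≤ √(2/3) ≤ 0.8165`. [folklore] -/
theorem sqrt_twoThirds_bounds' : (8164 / 10000 : ℝ) ≤ Real.sqrt (2 / 3) ∧ Real.sqrt (2 / 3) ≤ 8165 / 10000 := by
  constructor
  · rw [show (8164 / 10000 : ℝ) = Real.sqrt ((8164 / 10000) ^ 2) by rw [Real.sqrt_sq (by norm_num)]]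
    exact Real.sqrt_le_sqrt (by norm_num)
  · rw [show (8165 / 10000 : ℝ) = Real.sqrt ((8165 / 10000) ^ 2) by rw [Real.sqrt_sq (by norm_num)]]
    exact Real.sqrt_le_sqrt (by norm_num)

/-- The tube `|h − a√⅔| ≤ a/100` in squared form: `0.65 a² ≤ h² ≤ 0.69 a²` (and `0 < h`).
[folklore] -/
theorem tube_sq_bounds (ha : 0 < a) (ht : |h - a * Real.sqrt (2 / 3)| ≤ a / 100) :
    65 / 100 * a ^ 2 ≤ h ^ 2 ∧ h ^ 2 ≤ 69 / 100 * a ^ 2 ∧ 0 < h := by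
  obtain ⟨hs1, hs2⟩ := sqrt_twoThirds_bounds'
  obtain ⟨ht1, ht2⟩ := abs_le.1 ht
  have hlo : 8064 / 10000 * a ≤ h := by nlinarith
  have hhi : h ≤ 8265 / 10000 * a := by nlinarith
  have hpos : 0 < h := by nlinarith
  refine ⟨by nlinarith, by nlinarith, hpos⟩

/-- **The window lemma for relaxed hcp.** For `0.65a² ≤ h² ≤ 0.69a²` and a window radius `r` with
`12.28 a² ≤ 12r² ≤ 18.75 a²` (e.g. `r = 5a/4`, or `r = 28/25` when `a ∈ [9/10, 1]`): two distinct
sites of `hcpStacking a h` are within distance `r` iff the corresponding sites of the IDEAL hcp of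
spacing `a` touch (`dist = a`). Cases on `K = k − k'`: `K = 0` — in-layer form `≤ 18 ⇒ = 12`;
`|K| = 1` — adjacent form `≤ 10 ⇒ = 4`; `|K| ≥ 2` — both sides false (`48h² > 18.75a²`, `8K² > 12`).
[folklore] -/
theorem hcp_window_iff (ha : 0 < a) (hT1 : 65 / 100 * a ^ 2 ≤ h ^ 2) (hT2 : h ^ 2 ≤ 69 / 100 * a ^ 2)
    {r : ℝ} (hr0 : 0 ≤ r) (hr1 : 1228 / 100 * a ^ 2 ≤ 12 * r ^ 2) (hr2 : 12 * r ^ 2 ≤ 75 / 4 * a ^ 2)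
    (k i j k' i' j' : ℤ) :
    ((k, i, j) ≠ (k', i', j') ∧
        dist (barlowPos a h alternatingHagg k i j) (barlowPos a h alternatingHagg k' i' j') ≤ r) ↔
      dist (barlowPos a (a * Real.sqrt (2 / 3)) alternatingHagg k i j)
        (barlowPos a (a * Real.sqrt (2 / 3)) alternatingHagg k' i' j') = a := by
  rw [dist_barlowPos_eq_iff_form ha (idealRatio_sq a) alternatingHagg k i j k' i' j']
  have h12 := twelve_mul_dist_sq a h alternatingHagg k i j k' i' j'
  set Λ : ℤ := haggLabel alternatingHagg k - haggLabel alternatingHagg k' with hΛ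
  set F : ℤ := 3 * (2 * (i - i') + (j - j') + Λ) ^ 2 + (3 * (j - j') + Λ) ^ 2 with hF
  set D : ℝ := dist (barlowPos a h alternatingHagg k i j) (barlowPos a h alternatingHagg k' i' j') with hD
  have hD0 : 0 ≤ D := dist_nonneg
  have hF0 : (0 : ℤ) ≤ F := by rw [hF]; positivity
  have hF0' : (0 : ℝ) ≤ (F : ℝ) := by exact_mod_cast hF0
  have ha2 : 0 < a ^ 2 := by positivity
  -- `D ≤ r ↔ 12 D² ≤ 12 r²`
  have hDr : D ≤ r ↔ 12 * D ^ 2 ≤ 12 * r ^ 2 := by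
    constructor
    · intro hle; nlinarith [mul_self_le_mul_self hD0 hle]
    · intro hle
      exact (pow_le_pow_iff_left₀ hD0 hr0 two_ne_zero).1 (by nlinarith)
  rcases lt_trichotomy (k - k') 0 with hK | hK | hK
  · rcases eq_or_lt_of_le (Int.le_sub_one_iff.2 hK : k - k' ≤ -1) with hK1 | hK1
    · -- K = -1
      have hσ := haggLabel_alt_sub_of_adj (Or.inr hK1)
      rw [← hΛ] at hσ
      have hKr : ((k - k' : ℤ) : ℝ) = -1 := by exact_mod_cast hK1
      rw [hKr] at h12
      constructor
      · rintro ⟨-, hle⟩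
        have h1 : 12 * D ^ 2 ≤ 12 * r ^ 2 := hDr.1 hle
        have hFle : (F : ℝ) * a ^ 2 ≤ 1095 / 100 * a ^ 2 := by nlinarith
        have hF10 : F ≤ 10 := by
          by_contra hc
          have : (11 : ℝ) ≤ F := by exact_mod_cast (show (11 : ℤ) ≤ F by omega)
          nlinarith
        have hF4 : F = 4 := adjLayer_le_ten hσ hF10
        rw [hF4, hK1]; norm_num
      · intro hF12
        have hF4 : F = 4 := by rw [hK1] at hF12; omega
        refine ⟨fun heq => ?_, hDr.2 ?_⟩
        · simp only [Prod.mk.injEq] at heq; omega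
        · have : (F : ℝ) = 4 := by exact_mod_cast hF4
          rw [this] at h12; nlinarith
    · -- K ≤ -2 : both sides false
      have hK2 : (4 : ℝ) ≤ ((k - k' : ℤ) : ℝ) ^ 2 := by
        have : (k - k' : ℤ) ^ 2 ≥ 4 := by nlinarith
        exact_mod_cast this
      constructor
      · rintro ⟨-, hle⟩
        have h1 := hDr.1 hle
        nlinarith
      · intro hF12
        have : 8 * (k - k') ^ 2 ≤ 12 := by rw [← hF12]; linarith
        nlinarith
  · -- K = 0, Λ = 0
    have hk' : k = k' := by omega
    have hΛ0 : Λ = 0 := by rw [hΛ, hk', sub_self]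
    have hKr : ((k - k' : ℤ) : ℝ) = 0 := by exact_mod_cast hK
    rw [hKr] at h12
    have hF' : F = 3 * (2 * (i - i') + (j - j')) ^ 2 + (3 * (j - j')) ^ 2 := by rw [hF, hΛ0]; ring
    constructor
    · rintro ⟨hne, hle⟩
      have hPQ : (i - i', j - j') ≠ (0, 0) := by
        intro h0; simp only [Prod.mk.injEq, sub_eq_zero] at h0
        exact hne (by rw [hk', h0.1, h0.2])
      have h1 := hDr.1 hle
      have hFle : (F : ℝ) * a ^ 2 ≤ 75 / 4 * a ^ 2 := by nlinarith
      have hF18 : F ≤ 18 := by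
        by_contra hc
        have : (19 : ℝ) ≤ F := by exact_mod_cast (show (19 : ℤ) ≤ F by omega)
        nlinarith
      rw [hF'] at hF18 ⊢
      rw [inLayer_le_eighteen hF18 hPQ, hK]; norm_num
    · intro hF12
      rw [hK] at hF12
      have hF12' : F = 12 := by omega
      refine ⟨fun heq => ?_, hDr.2 ?_⟩
      · simp only [Prod.mk.injEq] at heq
        obtain ⟨-, rfl, rfl⟩ := heq
        rw [hF'] at hF12'; simp at hF12'
      · have : (F : ℝ) = 12 := by exact_mod_cast hF12'
        rw [this] at h12; nlinarith
  · rcases eq_or_lt_of_le (Int.add_one_le_iff.2 hK : 1 ≤ k - k') with hK1 | hK1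
    · -- K = 1
      have hσ := haggLabel_alt_sub_of_adj (Or.inl hK1.symm)
      rw [← hΛ] at hσ
      have hKr : ((k - k' : ℤ) : ℝ) = 1 := by exact_mod_cast hK1.symm
      rw [hKr] at h12
      constructor
      · rintro ⟨-, hle⟩
        have h1 : 12 * D ^ 2 ≤ 12 * r ^ 2 := hDr.1 hle
        have hFle : (F : ℝ) * a ^ 2 ≤ 1095 / 100 * a ^ 2 := by nlinarith
        have hF10 : F ≤ 10 := by
          by_contra hc
          have : (11 : ℝ) ≤ F := by exact_mod_cast (show (11 : ℤ) ≤ F by omega)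
          nlinarith
        have hF4 : F = 4 := adjLayer_le_ten hσ hF10
        rw [hF4, ← hK1]; norm_num
      · intro hF12
        have hF4 : F = 4 := by rw [← hK1] at hF12; omega
        refine ⟨fun heq => ?_, hDr.2 ?_⟩
        · simp only [Prod.mk.injEq] at heq; omega
        · have : (F : ℝ) = 4 := by exact_mod_cast hF4
          rw [this] at h12; nlinarith
    · -- K ≥ 2 : both sides false
      have hK2 : (4 : ℝ) ≤ ((k - k' : ℤ) : ℝ) ^ 2 := by
        have : (k - k' : ℤ) ^ 2 ≥ 4 := by nlinarith
        exact_mod_cast this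
      constructor
      · rintro ⟨-, hle⟩
        have h1 := hDr.1 hle
        nlinarith
      · intro hF12
        have : 8 * (k - k') ^ 2 ≤ 12 := by rw [← hF12]; linarith
        nlinarith

/-! ### The vertical stretch `tubeMap η h : z ↦ z + (z₂/η)(h − η)e₃` -/

/-- The vertical stretch taking layer spacing `η` to `h`. [folklore] -/
def tubeMap (η h : ℝ) (z : E3) : E3 := z + (z 2 / η) • (layerNormal h - layerNormal η)

/-- It maps the stacking of spacing `η` onto the stacking of spacing `h`, index by index. [folklore] -/
theorem tubeMap_barlowPos {η : ℝ} (hη : η ≠ 0) (a h : ℝ) (s : ℤ → ℤ) (k i j : ℤ) :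
    tubeMap η h (barlowPos a η s k i j) = barlowPos a h s k i j := by
  ext l
  fin_cases l <;> simp [tubeMap, barlowPos, triangularVec₁, triangularVec₂, barlowOffset, layerNormal]
  field_simp
  ring

/-- It is additive (indeed linear). [folklore] -/
theorem tubeMap_sub (η h : ℝ) (x y : E3) : tubeMap η h (x - y) = tubeMap η h x - tubeMap η h y := by
  simp only [tubeMap, PiLp.sub_apply, sub_div, sub_smul]
  abel

/-- Its displacement: `dist (tubeMap η h z) z = |z₂/η| · |h − η|`. [folklore] -/
theorem dist_tubeMap (η h : ℝ) (z : E3) : dist (tubeMap η h z) z = |z 2 / η| * |h - η| := by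
  rw [dist_eq_norm, tubeMap, add_sub_cancel_left, norm_smul, Real.norm_eq_abs]
  congr 1
  rw [EuclideanSpace.norm_eq, Fin.sum_univ_three]
  simp [layerNormal, Real.sqrt_sq_eq_abs]

/-- It is injective for `η, h ≠ 0`. [folklore] -/
theorem tubeMap_injective {η h : ℝ} (hη : η ≠ 0) (hh : h ≠ 0) : Function.Injective (tubeMap η h) := by
  intro x y hxy
  have h2 : x 2 = y 2 := by
    have := congrArg (fun z : E3 => z 2) hxy
    simp only [tubeMap, PiLp.add_apply, PiLp.smul_apply, PiLp.sub_apply, layerNormal, smul_eq_mul] at this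
    have hx : x 2 + x 2 / η * (h - η) = x 2 * (h / η) := by field_simp; ring
    have hy : y 2 + y 2 / η * (h - η) = y 2 * (h / η) := by field_simp; ring
    simp at this
    rw [hx, hy] at this
    exact mul_right_cancel₀ (div_ne_zero hh hη) this
  have hxy' : x + (x 2 / η) • (layerNormal h - layerNormal η) =
      y + (y 2 / η) • (layerNormal h - layerNormal η) := hxy
  rw [h2] at hxy'
  exact add_right_cancel hxy'

/-! ### Shells of relaxed hcp -/

/-- The ideal shell finset of cycle 1 IS the set of touching-neighbour offsets (as sets). [folklore] -/
theorem coe_shellFinset_eq (ha : 0 < a) (k i j : ℤ) :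
    (↑(shellFinset a k) : Set E3) =
      (fun y : E3 => y - barlowPos a (a * Real.sqrt (2 / 3)) alternatingHagg k i j) ''
        {y : E3 | y ∈ barlowStacking a (a * Real.sqrt (2 / 3)) alternatingHagg ∧
          dist (barlowPos a (a * Real.sqrt (2 / 3)) alternatingHagg k i j) y = a} := by
  refine Set.eq_of_subset_of_ncard_le (shellFinset_subset ha k i j) ?_ ?_
  · rw [Set.ncard_image_of_injective _ sub_left_injective,
      ncard_touching_eq_twelve isHaggSeq_alternating ha (idealRatio_sq a) (barlowPos_mem k i j),
      Set.ncard_coe_finset, card_shellFinset ha.ne']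
  · exact (Set.finite_of_ncard_pos (by
      rw [ncard_touching_eq_twelve isHaggSeq_alternating ha (idealRatio_sq a) (barlowPos_mem k i j)]
      norm_num)).image _

/-- Elements of the ideal shell finset have third coordinate `K·a√⅔` with `|K| ≤ 1`. [folklore] -/
theorem shellFinset_apply_two (ha : 0 < a) {k : ℤ} {z : E3} (hz : z ∈ shellFinset a k) :
    |z 2 / (a * Real.sqrt (2 / 3))| ≤ 1 := by
  have hz' : z ∈ (↑(shellFinset a k) : Set E3) := hz
  rw [coe_shellFinset_eq ha k 0 0] at hz'
  obtain ⟨y, ⟨hy, hd⟩, rfl⟩ := hz'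
  obtain ⟨k', i', j', rfl⟩ := hy
  have hF := (dist_barlowPos_eq_iff_form ha (idealRatio_sq a) alternatingHagg k 0 0 k' i' j').1 hd
  have hK : (k - k') ^ 2 ≤ 1 := by
    nlinarith [sq_nonneg (2 * (0 - i') + (0 - j') + (haggLabel alternatingHagg k - haggLabel alternatingHagg k')),
      sq_nonneg (3 * (0 - j') + (haggLabel alternatingHagg k - haggLabel alternatingHagg k'))]
  obtain ⟨hK1, hK2⟩ := abs_le_one_of_sq_le_one hK
  have hη : a * Real.sqrt (2 / 3) ≠ 0 := idealRatio_ne_zero ha.ne'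
  simp only [PiLp.sub_apply, barlowPos_apply_two]
  rw [show ((k' : ℝ) * (a * Real.sqrt (2 / 3)) - k * (a * Real.sqrt (2 / 3))) / (a * Real.sqrt (2 / 3)) =
      ((k' - k : ℤ) : ℝ) by push_cast; field_simp]
  rw [← Int.cast_abs]
  have : |k' - k| ≤ 1 := abs_le.2 ⟨by omega, by omega⟩
  exact_mod_cast this

/-- The relaxed shell finset at a site of layer `k`: the vertical stretch of the ideal one. [folklore] -/
def tubeShell (a h : ℝ) (k : ℤ) : Finset E3 :=
  (shellFinset a k).image (tubeMap (a * Real.sqrt (2 / 3)) h)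

/-- **The `5a/4`-window of a relaxed hcp site is exactly the stretched ideal shell.** [folklore] -/
theorem coe_tubeShell_eq (ha : 0 < a) (hh : 0 < h) (hT1 : 65 / 100 * a ^ 2 ≤ h ^ 2)
    (hT2 : h ^ 2 ≤ 69 / 100 * a ^ 2) (k i j : ℤ) :
    (↑(tubeShell a h k) : Set E3) =
      (fun y : E3 => y - barlowPos a h alternatingHagg k i j) ''
        {y : E3 | y ∈ hcpStacking a h ∧ y ≠ barlowPos a h alternatingHagg k i j ∧
          dist y (barlowPos a h alternatingHagg k i j) ≤ 5 / 4 * a} := by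
  have hη : a * Real.sqrt (2 / 3) ≠ 0 := idealRatio_ne_zero ha.ne'
  have hwin := fun k' i' j' => hcp_window_iff ha hT1 hT2 (r := 5 / 4 * a) (by positivity)
    (by nlinarith) (by nlinarith) k' i' j' k i j
  rw [tubeShell, Finset.coe_image, coe_shellFinset_eq ha k i j, Set.image_image]
  ext z
  simp only [Set.mem_image, Set.mem_setOf_eq]
  constructor
  · rintro ⟨y, ⟨hy, hd⟩, rfl⟩
    obtain ⟨k', i', j', rfl⟩ := hy
    rw [dist_comm] at hd
    obtain ⟨hne, hle⟩ := (hwin k' i' j').2 hd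
    refine ⟨barlowPos a h alternatingHagg k' i' j', ⟨barlowPos_mem _ _ _, fun heq => hne ?_, hle⟩, ?_⟩
    · by_contra hidx
      have hpos : 0 < min a h := lt_min ha hh
      have := le_dist_barlowPos a h alternatingHagg ha.le hh.le hidx
      rw [heq, dist_self] at this
      linarith
    · rw [tubeMap_sub, tubeMap_barlowPos hη, tubeMap_barlowPos hη]
  · rintro ⟨y, ⟨hy, hne, hle⟩, rfl⟩
    obtain ⟨k', i', j', rfl⟩ := hy
    have hidx : (k', i', j') ≠ (k, i, j) := by
      rintro heq
      simp only [Prod.mk.injEq] at heq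
      obtain ⟨rfl, rfl, rfl⟩ := heq
      exact hne rfl
    refine ⟨barlowPos a (a * Real.sqrt (2 / 3)) alternatingHagg k' i' j',
      ⟨barlowPos_mem _ _ _, ?_⟩, ?_⟩
    · rw [dist_comm]; exact (hwin k' i' j').1 ⟨hidx, hle⟩
    · rw [tubeMap_sub, tubeMap_barlowPos hη, tubeMap_barlowPos hη]

/-- **Matching by a small injective motion**: if `φ` moves every point of `P` by `≤ η`, then
`P.image φ` is `η`-matched to `P`. [folklore] -/
theorem etaMatched_image_of_dist_le {η : ℝ} {P : Finset E3} {φ : E3 → E3} (hφ : Function.Injective φ)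
    (hd : ∀ p ∈ P, dist (φ p) p ≤ η) : EtaMatched η (P.image φ) P := by
  classical
  let f : ↥P → ↥(P.image φ) := fun p => ⟨φ p, Finset.mem_image_of_mem φ p.2⟩
  have hf : Function.Bijective f := by
    constructor
    · intro p q hpq
      exact Subtype.ext (hφ (congrArg Subtype.val hpq))
    · rintro ⟨t, ht⟩
      obtain ⟨p, hp, rfl⟩ := Finset.mem_image.1 ht
      exact ⟨⟨p, hp⟩, rfl⟩
  let e : ↥P ≃ ↥(P.image φ) := Equiv.ofBijective f hf
  refine ⟨e.symm, fun t => ?_⟩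
  have ht : (t : E3) = φ (e.symm t : E3) := by
    have := e.apply_symm_apply t
    exact (congrArg Subtype.val this).symm
  rw [ht]
  exact hd _ (e.symm t).2

/-- **Every point of relaxed hcp in the tube has a `(1/100)`-good HCP shell.** [folklore] -/
theorem goodShell_hcp_tube (h9 : 9 / 10 ≤ a) (h1 : a ≤ 1) (ht : |h - a * Real.sqrt (2 / 3)| ≤ a / 100)
    {p : E3} (hp : p ∈ hcpStacking a h) : GoodShell (hcpStacking a h) p := by
  have ha : 0 < a := by linarith
  obtain ⟨hT1, hT2, hpos⟩ := tube_sq_bounds ha ht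
  have hη : a * Real.sqrt (2 / 3) ≠ 0 := idealRatio_ne_zero ha.ne'
  obtain ⟨k, i, j, rfl⟩ := hp
  refine ⟨a, h9, h1, tubeShell a h k, coe_tubeShell_eq ha hpos hT1 hT2 k i j, Or.inr ⟨siteIso k, ?_⟩⟩
  change EtaMatched (a / 100) (tubeShell a h k) (shellFinset a k)
  refine etaMatched_image_of_dist_le (tubeMap_injective hη hpos.ne') fun z hz => ?_
  rw [dist_tubeMap]
  calc |z 2 / (a * Real.sqrt (2 / 3))| * |h - a * Real.sqrt (2 / 3)|
      ≤ 1 * (a / 100) := mul_le_mul (shellFinset_apply_two ha hz) ht (abs_nonneg _) zero_le_one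
    _ = a / 100 := one_mul _

/-- **Relaxed hcp in the tube is Barlow-like**: `Φ = tubeMap ∘ (a • ·)` is a bijection from the unit
ideal hcp onto `hcpStacking a h` carrying unit contacts exactly onto the pairs at distance in
`(0, 28/25]` (window lemma with `r = 28/25`, which needs `a ∈ [9/10, 1]`). [folklore] -/
theorem barlowLike_hcp_tube (h9 : 9 / 10 ≤ a) (h1 : a ≤ 1) (ht : |h - a * Real.sqrt (2 / 3)| ≤ a / 100) :
    BarlowLike (hcpStacking a h) := by
  have ha : 0 < a := by linarith
  obtain ⟨hT1, hT2, hpos⟩ := tube_sq_bounds ha ht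
  have hη : a * Real.sqrt (2 / 3) ≠ 0 := idealRatio_ne_zero ha.ne'
  set Φ : E3 → E3 := fun z => tubeMap (a * Real.sqrt (2 / 3)) h (a • z) with hΦ
  have hΦpos : ∀ k i j, Φ (barlowPos 1 (Real.sqrt (2 / 3)) alternatingHagg k i j) =
      barlowPos a h alternatingHagg k i j := fun k i j => by
    rw [hΦ]; dsimp only; rw [barlowPos_smul, tubeMap_barlowPos hη]
  have hΦinj : Function.Injective Φ :=
    (tubeMap_injective hη hpos.ne').comp (smul_right_injective E3 ha.ne')
  refine ⟨alternatingHagg, isHaggSeq_alternating, Φ, ⟨?_, hΦinj.injOn, ?_⟩, ?_⟩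
  · rintro _ ⟨k, i, j, rfl⟩
    rw [hΦpos]; exact barlowPos_mem _ _ _
  · rintro _ ⟨k, i, j, rfl⟩
    exact ⟨_, barlowPos_mem k i j, hΦpos k i j⟩
  · rintro _ ⟨k, i, j, rfl⟩ _ ⟨k', i', j', rfl⟩
    rw [hΦpos, hΦpos]
    have hwin := hcp_window_iff ha hT1 hT2 (r := 28 / 25) (by norm_num) (by nlinarith) (by nlinarith)
      k i j k' i' j'
    -- unit contact ↔ contact at spacing `a` in the `a`-scaled ideal stacking
    have hscale : dist (barlowPos 1 (Real.sqrt (2 / 3)) alternatingHagg k i j)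
        (barlowPos 1 (Real.sqrt (2 / 3)) alternatingHagg k' i' j') = 1 ↔
        dist (barlowPos a (a * Real.sqrt (2 / 3)) alternatingHagg k i j)
          (barlowPos a (a * Real.sqrt (2 / 3)) alternatingHagg k' i' j') = a := by
      rw [← barlowPos_smul, ← barlowPos_smul, dist_smul₀, Real.norm_of_nonneg ha.le]
      constructor
      · intro h1'; rw [h1', mul_one]
      · intro h2'; exact mul_left_cancel₀ ha.ne' (by rw [h2', mul_one])
    rw [hscale, ← hwin]
    constructor
    · rintro ⟨hne, hle⟩
      refine ⟨?_, hle⟩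
      have hmin : 0 < min a h := lt_min ha hpos
      exact lt_of_lt_of_le hmin (le_dist_barlowPos a h alternatingHagg ha.le hpos.le hne)
    · rintro ⟨hlt, hle⟩
      refine ⟨fun heq => ?_, hle⟩
      simp only [Prod.mk.injEq] at heq
      obtain ⟨rfl, rfl, rfl⟩ := heq
      rw [dist_self] at hlt
      exact lt_irrefl _ hlt

/-! ### The relaxed intended model -/

/-- The motif of `hcpPeriodicConfiguration` is `{0, b}`, `b` the `B`-site `barlowPos a h 1 0 0`.
[folklore] -/
theorem mem_hcp_motif (ha : a ≠ 0) (hh : h ≠ 0) {x : E3} (hx : x ∈ (hcpPeriodicConfiguration ha hh).motif) :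
    x = 0 ∨ x = barlowPos a h alternatingHagg 1 0 0 := by
  change x ∈ (Finset.range 2).image (fun m : ℕ => barlowPos a h alternatingHagg m 0 0) at hx
  obtain ⟨m, hm, rfl⟩ := Finset.mem_image.1 hx
  rw [Finset.mem_range] at hm
  interval_cases m
  · left; ext l; fin_cases l <;> simp
  · right; rfl

/-- **The relaxed intended model satisfies H1, H2, H4**: the Palm law of `hcpStacking a h`,
`a ∈ [9/10, 1]`, `|h − a√⅔| ≤ a/100` (rooted and `(4a/5)`-separated). [folklore] -/
theorem hcpPalm_hypotheses_tube (h9 : 9 / 10 ≤ a) (h1 : a ≤ 1) (ht : |h - a * Real.sqrt (2 / 3)| ≤ a / 100)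
    (hh : h ≠ 0) :
    IsProbabilityMeasure (palmLaw (hcpPeriodicConfiguration (show a ≠ 0 by intro h0; rw [h0] at h9; norm_num at h9) hh)) ∧
    Rooted (4 / 5 * a) (palmLaw (hcpPeriodicConfiguration (show a ≠ 0 by intro h0; rw [h0] at h9; norm_num at h9) hh)) ∧
    PointStationary (palmLaw (hcpPeriodicConfiguration (show a ≠ 0 by intro h0; rw [h0] at h9; norm_num at h9) hh)) ∧
    Layered (palmLaw (hcpPeriodicConfiguration (show a ≠ 0 by intro h0; rw [h0] at h9; norm_num at h9) hh)) := by
  have ha : 0 < a := by linarith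
  obtain ⟨hT1, hT2, hpos⟩ := tube_sq_bounds ha ht
  set Q := hcpPeriodicConfiguration (show a ≠ 0 by intro h0; rw [h0] at h9; norm_num at h9) hh with hQ
  have hpts : Q.points = hcpStacking a h := hcpPeriodicConfiguration_points ha.ne' hh
  refine ⟨inferInstance, ?_, pointStationary_palmLaw Q, ?_⟩
  · refine rooted_palmLaw Q fun p hp q hq hne => ?_
    rw [hpts] at hp hq
    have h45 : 4 / 5 * a ≤ min a h := le_min (by linarith) (by nlinarith)
    exact h45.trans (le_dist_of_mem_barlowStacking a h alternatingHagg ha.le hpos.le hp hq hne)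
  · refine ae_palmLaw Q fun x _ => ⟨view Q x, rfl, ?_, ?_⟩
    · rintro _ ⟨p, hp, rfl⟩
      refine goodShell_image_sub x ?_
      rw [hpts] at hp ⊢
      exact goodShell_hcp_tube h9 h1 ht hp
    · refine barlowLike_image_sub x ?_
      rw [hpts]
      exact barlowLike_hcp_tube h9 h1 ht

/-- **H1 ∧ H2 ∧ H4 hold for the whole relaxed family** — in particular for the numerically relaxed
Lennard-Jones hcp `(a*, h*) ≈ (0.9713, 0.7929)`, `|h* − a*√⅔| ≈ 1.2·10⁻⁴ ≪ a*/100`: at the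
rational point `(9713/10000, 7929/10000)`. [folklore] -/
theorem hcpPalm_hypotheses_numerical :
    ∃ P : Measure (Measure E3), IsProbabilityMeasure P ∧ Rooted (4 / 5 * (9713 / 10000)) P ∧
      PointStationary P ∧ Layered P ∧
      meanRootEnergy P = (hcpPeriodicConfiguration (a := (9713 / 10000 : ℝ)) (h := (7929 / 10000 : ℝ))
        (by norm_num) (by norm_num)).energyPerParticle lennardJones := by
  have ht : |(7929 / 10000 : ℝ) - 9713 / 10000 * Real.sqrt (2 / 3)| ≤ 9713 / 10000 / 100 := by
    obtain ⟨hs1, hs2⟩ := sqrt_twoThirds_bounds'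
    rw [abs_le]; constructor <;> nlinarith
  obtain ⟨h0, hr, h2, h4⟩ := hcpPalm_hypotheses_tube (a := 9713 / 10000) (h := 7929 / 10000)
    (by norm_num) (by norm_num) ht (by norm_num)
  exact ⟨_, h0, hr, h2, h4, meanRootEnergy_palmLaw _⟩

/-- **The conclusion of the crux HOLDS for the relaxed intended model** whenever `e(hcp a h) = e*`:
the two views are `hcpStacking a h` and `−hcpStacking a h` (§10), `A = ±id`, and
`(a, h) ∈ [9/10, 1] × [0.72, 0.83] ⊂ [1/2, 2]²`. [folklore] -/
theorem hcpPalm_conclusion_tube (h9 : 9 / 10 ≤ a) (h1 : a ≤ 1) (ht : |h - a * Real.sqrt (2 / 3)| ≤ a / 100)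
    (hh : h ≠ 0)
    (hE : (hcpPeriodicConfiguration (show a ≠ 0 by intro h0; rw [h0] at h9; norm_num at h9) hh).energyPerParticle
      lennardJones = eStar) :
    ∀ᵐ μ ∂(palmLaw (hcpPeriodicConfiguration (show a ≠ 0 by intro h0; rw [h0] at h9; norm_num at h9) hh)),
      IsRelaxedHcp μ := by
  have ha : 0 < a := by linarith
  have ha' : a ≠ 0 := ha.ne'
  obtain ⟨hs1, hs2⟩ := sqrt_twoThirds_bounds'
  obtain ⟨ht1, ht2⟩ := abs_le.1 ht
  have hbox : 1 / 2 ≤ h ∧ h ≤ 2 := by constructor <;> nlinarith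
  refine ae_palmLaw _ fun x hx => ?_
  have hpts := hcpPeriodicConfiguration_points ha' hh
  rcases mem_hcp_motif ha' hh hx with rfl | rfl
  · refine ⟨a, h, ha', hh, by linarith, by linarith, hbox.1, hbox.2, LinearIsometryEquiv.refl ℝ E3, hE, ?_⟩
    unfold viewMeasure view
    congr 1
    rw [hpts]
    ext z
    simp
  · refine ⟨a, h, ha', hh, by linarith, by linarith, hbox.1, hbox.2, LinearIsometryEquiv.neg ℝ, hE, ?_⟩
    unfold viewMeasure view
    congr 1
    rw [hpts, hcpStacking_sub_b_eq_neg]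
    ext z
    simp

/-- **Consistency / non-vacuity of the crux on its PHYSICALLY intended witness, modulo the periodic
crystal problem.** If relaxed hcp at some admissible `(a, h)` — `a ∈ [9/10, 1]`, `|h − a√⅔| ≤ a/100`,
a tube containing the numerically relaxed Lennard-Jones hcp — minimises the energy per particle over
periodic configurations (`e(hcp a h) = e*`, which is what Stillinger 2001 / Schwerdtfeger–Burrows–Smits
2021 / kit j012726, j013916 indicate), then its Palm law satisfies ALL FOUR hypotheses of the crux AND
the conclusion. (Supersedes the sanity check `crux_consistent`, whose ideal-ratio premise is
numerically false.) [folklore] -/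
theorem crux_consistent_tube (h9 : 9 / 10 ≤ a) (h1 : a ≤ 1) (ht : |h - a * Real.sqrt (2 / 3)| ≤ a / 100)
    (hh : h ≠ 0)
    (hE : (hcpPeriodicConfiguration (show a ≠ 0 by intro h0; rw [h0] at h9; norm_num at h9) hh).energyPerParticle
      lennardJones = eStar) :
    ∃ P : Measure (Measure E3), IsProbabilityMeasure P ∧ Rooted (4 / 5 * a) P ∧ PointStationary P ∧
      meanRootEnergy P ≤ eStar ∧ Layered P ∧ ∀ᵐ μ ∂P, IsRelaxedHcp μ := by
  obtain ⟨h0, hr, h2, h4⟩ := hcpPalm_hypotheses_tube h9 h1 ht hh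
  exact ⟨_, h0, hr, h2, by rw [meanRootEnergy_palmLaw]; exact hE.le, h4, hcpPalm_conclusion_tube h9 h1 ht hh hE⟩

/-- **The crux restricted to the relaxed hcp family is pure attainment**: for `(a, h)` in the tube,
`crux ⇒ (e(hcp a h) ≤ e* ⇒ e(hcp a h) = e*)` carries no structural information (the sample IS
`hcpStacking a h`); the whole content of the crux on this family is `e* ≤ e(hcp a h)` (item 0714).
Conversely NOTHING in H1, H2, H4 distinguishes the members of the family from each other or from fcc
(§7): the selection of `(a, h)` is entirely H3's. [folklore] -/
theorem hcp_tube_family_layered (h9 : 9 / 10 ≤ a) (h1 : a ≤ 1) (ht : |h - a * Real.sqrt (2 / 3)| ≤ a / 100)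
    (hh : h ≠ 0) :
    Layered (palmLaw (hcpPeriodicConfiguration (show a ≠ 0 by intro h0; rw [h0] at h9; norm_num at h9) hh)) ∧
    (meanRootEnergy (palmLaw (hcpPeriodicConfiguration (show a ≠ 0 by intro h0; rw [h0] at h9; norm_num at h9) hh))
        ≤ eStar ↔
      (hcpPeriodicConfiguration (show a ≠ 0 by intro h0; rw [h0] at h9; norm_num at h9) hh).energyPerParticle
        lennardJones = eStar) := by
  refine ⟨(hcpPalm_hypotheses_tube h9 h1 ht hh).2.2.2, ?_⟩
  rw [meanRootEnergy_palmLaw]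
  exact ⟨fun hle => le_antisymm hle (eStar_le _), fun heq => heq.le⟩


/-! ### The energy per particle of (relaxed) hcp is ONE root lattice sum -/

/-- Re-indexing a `tsum` over the image of an injective map. [folklore] -/
theorem tsum_image_eq {S : Set E3} {g : E3 → E3} (hg : Function.Injective g) (f : E3 → ℝ) :
    ∑' z : ↥(g '' S), f z = ∑' y : ↥S, f (g y) := by
  rw [← Equiv.tsum_eq (Equiv.Set.image g S hg)]
  rfl

/-- **`e(hcp a h) = ½ ∑'_{y ∈ hcpStacking a h} V_LJ(‖y‖)`** for every `a, h ≠ 0`: both motif views of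
the hcp Palm law have the same root sum (the `B`-view is `−hcp`, §10, and `‖−y‖ = ‖y‖`), so the energy
per particle of the two-point-motif configuration is the single lattice sum seen from one site (root
term `V_LJ(0) = 0` included harmlessly). Hence H3 for the relaxed intended model, and the energy clause
`e(hcp a h) = e*` of the crux's conclusion, are statements about ONE explicit absolutely convergent
series `(a, h) ↦ ½∑ V_LJ(√(a²(i²+ij+j²+L(i+j)+L/3) + k²h²))` versus `e*`. [folklore] -/
theorem energyPerParticle_hcp_eq_half_tsum (ha : a ≠ 0) (hh : h ≠ 0) :
    (hcpPeriodicConfiguration ha hh).energyPerParticle lennardJones =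
      (1 / 2) * ∑' y : ↥(hcpStacking a h), lennardJones ‖(y : E3)‖ := by
  set Q := hcpPeriodicConfiguration ha hh with hQ
  have hpts : Q.points = hcpStacking a h := hcpPeriodicConfiguration_points ha hh
  rw [← meanRootEnergy_palmLaw Q]
  unfold meanRootEnergy
  rw [integral_palmLaw]
  set T : ℝ := ∑' y : ↥(hcpStacking a h), lennardJones ‖(y : E3)‖ with hT
  have hterm : ∀ x ∈ Q.motif, (∫ y, lennardJones ‖y‖ ∂viewMeasure Q x) / 2 = T / 2 := by
    intro x hx
    rw [integral_lennardJones_viewMeasure Q (Q.mem_points_of_mem_motif hx)]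
    congr 1
    have hre : ∑' p : ↥Q.points, lennardJones ‖(p : E3) - x‖ =
        ∑' z : ↥((fun p : E3 => p - x) '' Q.points), lennardJones ‖(z : E3)‖ :=
      (tsum_image_eq (sub_left_injective) (fun z => lennardJones ‖z‖)).symm
    rw [hre, hpts]
    rcases mem_hcp_motif ha hh hx with rfl | rfl
    · have h0 : (fun p : E3 => p - 0) '' hcpStacking a h = hcpStacking a h := by
        simp only [sub_zero, Set.image_id']
      rw [tsum_congr_set_coe (fun z : E3 => lennardJones ‖z‖) h0]
    · rw [tsum_congr_set_coe (fun z : E3 => lennardJones ‖z‖) (hcpStacking_sub_b_eq_neg a h),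
        tsum_image_eq (g := fun z : E3 => -z) (fun x y hxy => neg_injective hxy) (fun z => lennardJones ‖z‖)]
      simp only [norm_neg]
      rfl
  rw [Finset.sum_congr rfl hterm, Finset.sum_const, nsmul_eq_mul, ← mul_assoc,
    inv_mul_cancel₀ (by exact_mod_cast Q.motif_nonempty.card_pos.ne'), one_mul]
  ring

/-- So **H3 for the relaxed hcp Palm law is the single series inequality**
`½ ∑'_{y ∈ hcp(a,h)} V_LJ(‖y‖) ≤ e*` (equivalently `= e*`, by item 0714). [folklore] -/
theorem hcpPalm_energy_iff_tsum (ha : a ≠ 0) (hh : h ≠ 0) :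
    meanRootEnergy (palmLaw (hcpPeriodicConfiguration ha hh)) ≤ eStar ↔
      (1 / 2) * ∑' y : ↥(hcpStacking a h), lennardJones ‖(y : E3)‖ = eStar := by
  rw [meanRootEnergy_palmLaw, energyPerParticle_hcp_eq_half_tsum]
  exact ⟨fun hle => le_antisymm hle (by rw [← energyPerParticle_hcp_eq_half_tsum ha hh]; exact eStar_le _),
    fun heq => heq.le⟩

end RelaxedHcp


/-! ## §24 Pre-triage of the ideators' typed first lemmas (for the lead; prose, cycle 2)

No line is picked yet (`targets = []`). Reading `IdeatorOneSketch.lean` / `IdeatorTwoSketch.lean` against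
this file and the ideators' own kit runs, the disprover's expectations for the stubs AS TYPED:

* `IdeatorOne.PrestressSplitWithWork` — TRUE, pure algebra (`‖r+δ‖² = ‖r‖² + 2⟪r,δ⟫ + ‖δ‖²`; the symmetry
  hypothesis on `ω` is not even needed). Provable now.
* `IdeatorOne.LennardJonesIsSq` — TRUE (`(r⁻¹)¹² = ((r²)⁻¹)⁶`). Provable now.
* `IdeatorOne.IdealStackingForcesVertical`, `IdeatorOne.HcpSiteForceZero` — TRUE for all `a, h > 0` by the
  three-fold axis (every word) and the horizontal mirror through an hcp layer (layers `m ± k` carry the same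
  letter); the only Lean cost is absolute convergence of the force `tsum` in `E3` (`r⁻⁷`).
* `IdeatorOne.HcpZeroStress` — TRUE as typed (interior minimiser on the open quadrant ⇒ `∂_a e = ∂_h e = 0`
  ⇒ `S₁₁ + S₂₂ = 0 = S₃₃`; `S₁₁ = S₂₂`, `S₁₂ = 0` by the three-fold axis, `S₁₃ = S₂₃ = 0` by the horizontal
  mirror), but needs termwise differentiability of the site-energy series; its hypothesis is satisfiable
  (the sublevel set `{e ≤ −0.1}` is compact in the open quadrant). NOTE the hypothesis is about the minimiser
  of the hcp FAMILY, not about `e*`: no crystal problem inside.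
* `IdeatorOne.CutForceCouplingBound` (`∑_{k≥2} k|g_k| ≤ 24|J₂|` on the 3063 box) — numerics-dependent;
  triage j012726 reports `∑k|g_k|/|J₂| = 16.7` at the hcp optimum; the box corners are untested (candidate
  target for the disprover once filed).
* `IdeatorTwo.SlabCoercivity lam` and `IdeatorTwo.SlabCoercivityFull lam` — numerically FALSE for every
  `lam > 0` by the ideator's OWN runs: the isolated bilayer slab form (short part `rc = 37/25`, kit j008774:
  min Bloch eigenvalue `−5.9·10⁻³` at 18/575 small-`k` points; full intra-slab range `6`, kit j010557:
  `−0.044|k|²` in one transverse branch) is not positive semidefinite, so a long-wave finitely supported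
  packet `u` has `slabForm u < 0 ≤ lam · slabStretch u`. Both are superseded in the card by
  `LayerTransferCertificate` (storage functional passed layer to layer), which is the only slab-level
  statement consistent with those numerics. A line filing either `SlabCoercivity*` stub is dead on arrival;
  a formal kill would need an explicit ~800-site packet and `iteratedFDeriv` bookkeeping (not attempted).
* `IdeatorTwo.HaggDominationCurrent` — TRUE-looking (Peierls count as a bounded covariant current; checked by
  hand on hcp — increments `≥ 0`, `t` constant works — and on fcc — reduces to
  `−|J₂|/2 + ∑_{4|k…} ≤ ∑_{3|k} J_k`, implied by half-domination). Provable from 0737's combinatorics.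
* `IdeatorTwo.CalibrationKillsDefects` — TRUE (integrate the a.e. inequality; signed Mecke from the `ℝ≥0∞`
  one under the two finiteness hypotheses; `μ ↦ ∫V dμ` is Giry-measurable and bounded on `δ`-separated
  samples, so no Bochner junk can bite).
* `IdeatorTwo.FirstVariationVanishes` — TRUE-looking: test the hypothesis with `v = ±rootForce` (bounded and
  measurable under the hard core); Mecke turns the first variation in direction `F` into `−E_P‖F‖²`.
Numbers any line will need, now interval-certified here (§23): `e_fcc − e_hcp ≥ 7.185·10⁻⁵` on the tube,
every period-`≤ 8` polytype above hcp by `≥ 9.7·10⁻⁶`, `e* ≤ −0.7175889`; floats: `J₂ = −7.265·10⁻⁵`,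
`J₃ = −8.5·10⁻⁸`, domination `414`, fault relaxation gains `≤ 1.4·10⁻⁷`.
-/

end Summit.AtomisticToContinuum.Crystallization.Cruxes.LayeredLawsSelectHcp.Disproof

end
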